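/-
Copyright (c) 2026. All rights reserved.
Released under Apache 2.0 license as described in the file LICENSE.
Authors: HodgeCM publication cell (pub/hodgecm-mathlib), Track B, seat K2E3-p11 (g4).
-/
import Summits.HodgeConjecture.HodgeConjecture.Theorems.K2E3GL3RegularRichardsonFourier   -- ★ p857495 (this seat): `matrixFourier_conj_apply`; brings ★ p857303, ★ p856457, ★ Ad-invariance
import Literature.NumberTheory.Automorphic.GLnLeviQuotientIwasawaIntegration              -- ★ `exists_boxHomeomorph_unipotentRadicalGL`
import HarnessLib

/-!
# K2_E3 road (h413), Richardson road, brick (F-link-E) — the Fourier transform of the MINIMAL Richardson measure of `𝔤𝔩₃(F)` is the `K`-average of the `(2,1)`-parabolic slice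

Cell `pub/hodgecm-mathlib` (D-0151), Track B, seat K2E3-p11 (g4) (Richardson road owner; squad bus 2026-09-04T05:03Z).
`--supports stmt-HodgeConjecture-24833 --as helper`; THEOREMS ONLY (no definition ∕ instance ∕ notation ∕ named fact ∕ `sorry`); never imports
`Cruxes/…/Lines`.  COUNT-NEUTRAL ((LBGL-ge3) stays OPEN).

THE MATHEMATICS.  `G = GL₃(F)`, `K = GL₃(𝒪)`, `U = U_c` the unipotent radical of the maximal parabolic `P_{(2,1)}` (`c = ![false, false, true]`), `𝔫 = 𝔫_c`
(entries `(0,2), (1,2)`), `𝔭 = 𝔭_c = {Y | Y₂₀ = Y₂₁ = 0}` its trace-annihilator, `𝓕f(Y) = ∫ ψ(tr(Y X)) f(X) dμ𝔤`.  The minimal Richardson measure in the currency of ★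
`gl3_nilpotentStructure` (p857476) is `Λ_E(φ) = ∫_{K × U} φ(k (u − 1) k⁻¹) d(κ ⊗ μ_U)`.  THIS FILE:
* §1 (any `n`, any two-block `c`) `exists_haar_eq_smul_map_box` — the Haar measure of `U_c(F)` is `C • Φ_*(dx^{I×J})` for the ★ box chart `Φ` (`Φ(x) = 1 + X`);
  `exists_boxNilChart` — the linear chart `F^{I×J} ≃L 𝔫_c` in the currency of ★ `integral_matrixFourier_nilradical_eq_parabolic`;
* §2 (`n = 3`) `exists_parabolicChart21` — `F⁷ ≃L 𝔭_{(2,1)}`, `r ↦ [[r₀,r₁,r₂],[r₃,r₄,r₅],[0,0,r₆]]`;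
* §3 **`exists_integral_prod_matrixFourier_minimalRichardson_eq`** — ONE `C > 0` with, for every `f ∈ C_c^∞(𝔤𝔩₃(F))`,
  `∫_{K × U} 𝓕f(k (u − 1) k⁻¹) d(κ ⊗ μ_U) = C · ∫_K ∫_{F⁷} f(k [[r₀,r₁,r₂],[r₃,r₄,r₅],[0,0,r₆]] k⁻¹) dr dk` — `Λ_E ∘ 𝓕 = C · (K-average of the parabolic slice 𝔭)`,
  the input of the `(2,1)`-parabolic slice density (F-E).  Same road as ★ (F-link-J) `K2E3GL3RegularRichardsonFourier`.
[HarishChandra1999AdmissibleDistributions, §7, Thm. 4.4] [Howe1974, Prop. 3] [WeilBNT1967, Ch. I §2, Ch. VII §2] [BernsteinZelevinsky1977, §2.1].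

References: [HarishChandra1999AdmissibleDistributions] Harish-Chandra (DeBacker–Sally), AMS ULECT 16 (1999) · [Howe1974] R. Howe, Math. Ann. 208 (1974) ·
[WeilBNT1967] A. Weil, *Basic Number Theory* (1967) · [BernsteinZelevinsky1977] Ann. Sci. ÉNS 10 (1977), §2.1.
-/

set_option autoImplicit false
set_option linter.dupNamespace false   -- `Summit.HodgeConjecture.HodgeConjecture.…` (D-0017 nested layout; lakefile exemption for Summits)

noncomputable section

open MeasureTheory MeasureTheory.Measure Filter Topology TopologicalSpace
open scoped MatrixGroups NNReal ENNReal
open Literature.NumberTheory.Rogawski1990 Literature.NumberTheory.Automorphic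
open Literature.NumberTheory.GaloisRepresentations Literature.NumberTheory.GaloisRepresentations.IsNonarchimedeanLocalField
open Summit.HodgeConjecture.HodgeConjecture.Cruxes.H413.K2E3LieSubspaceFourier (integral_matrixFourier_nilradical_eq_parabolic)
open Summit.HodgeConjecture.HodgeConjecture.Cruxes.H413.K2E3GLnNilpotentFourierPointSupport (isLocSmooth_matrixFourier)
open Summit.HodgeConjecture.HodgeConjecture.Cruxes.H413.K2E3GL3RegularRichardsonFourier (matrixFourier_conj_apply)

namespace Summit.HodgeConjecture.HodgeConjecture.Cruxes.H413.K2E3GL3MinimalRichardsonFourier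

variable {F : Type*} [Field F] [ValuativeRel F] [TopologicalSpace F] [IsNonarchimedeanLocalField F]

/-! ## §1  Two-block unipotent radicals: Haar measure in the box chart, and the linear chart of `𝔫_c` -/

section Box

variable {n : ℕ} (c : Fin n → Bool)

/-- **The Haar measure of `U_c(F)` in the box chart** (any two-block labelling `c : Fin n → Bool`): for the ★ box chart `Φ : F^{I×J} ≃ₜ U_c`
(`Φ(x) = 1 + X`, additive, ★ `exists_boxHomeomorph_unipotentRadicalGL`) and an additive Haar measure `dx` on `F`, every Haar measure on `U_c(F)` is
`C • Φ_*(⊗ dx)` with `C ≠ 0` (`Φ_*(⊗ dx)` is left invariant because `Φ` is additive; Haar uniqueness). [cite: WeilBNT1967, Chap. I §2, Th. 3 Cor. 3]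
[cite: BernsteinZelevinsky1977, §2.1] -/
theorem exists_haar_eq_smul_map_box [MeasurableSpace F] [BorelSpace F]
    [MeasurableSpace ↥(unipotentRadicalGL F c)] [BorelSpace ↥(unipotentRadicalGL F c)]
    (dx : Measure F) [dx.IsAddHaarMeasure] (μU : Measure ↥(unipotentRadicalGL F c)) [IsHaarMeasure μU] :
    ∃ Φ : ({i : Fin n // c i = false} × {j : Fin n // c j = true} → F) ≃ₜ ↥(unipotentRadicalGL F c),
      (∀ x (i j : Fin n), (((Φ x : ↥(unipotentRadicalGL F c)) : GL (Fin n) F) : Matrix (Fin n) (Fin n) F) i j =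
          (if i = j then 1 else 0) + if h : c i = false ∧ c j = true then x (⟨i, h.1⟩, ⟨j, h.2⟩) else 0) ∧
      ∃ C : ℝ≥0, C ≠ 0 ∧ μU = C • (Measure.pi fun _ : {i : Fin n // c i = false} × {j : Fin n // c j = true} => dx).map Φ := by
  haveI : T2Space F := (isLocalField F).toT2Space
  haveI : LocallyCompactSpace F := (isLocalField F).toLocallyCompactSpace
  haveI : SecondCountableTopology F := secondCountableTopology_localField F
  haveI : IsTopologicalRing F := inferInstance
  obtain ⟨Φ, hΦ, hadd⟩ := exists_boxHomeomorph_unipotentRadicalGL (R := F) c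
  haveI : SecondCountableTopology ↥(unipotentRadicalGL F c) := Φ.symm.secondCountableTopology
  haveI : LocallyCompactSpace ↥(unipotentRadicalGL F c) := Φ.symm.isClosedEmbedding.locallyCompactSpace
  set vol : Measure ({i : Fin n // c i = false} × {j : Fin n // c j = true} → F) := Measure.pi fun _ => dx with hvol
  have hme : Measurable Φ := Φ.continuous.measurable
  haveI : IsHaarMeasure (vol.map Φ) :=
    { map_mul_left_eq_self := fun g => by
        obtain ⟨x₀, rfl⟩ := Φ.surjective g
        have hcomp : (fun u => Φ x₀ * u) ∘ Φ = Φ ∘ fun x => x₀ + x := funext fun x => (hadd x₀ x).symm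
        rw [map_map (measurable_const_mul _) hme, hcomp, ← map_map hme (measurable_const_add x₀), map_add_left_eq_self]
      lt_top_of_isCompact := (IsFiniteMeasureOnCompacts.map _ Φ).lt_top_of_isCompact
      open_pos := (Φ.continuous.isOpenPosMeasure_map Φ.surjective).open_pos }
  exact ⟨Φ, hΦ, haarScalarFactor μU (vol.map Φ), (haarScalarFactor_pos_of_isHaarMeasure _ _).ne', isMulLeftInvariant_eq_smul μU _⟩

omit [ValuativeRel F] [IsNonarchimedeanLocalField F] in
/-- **The linear chart of the nilradical `𝔫_c`** (any two-block `c`): a subspace `𝔫 = {X | X i j = 0 unless c i = false, c j = true}` — equivalently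
`{X | c j ≤ c i → X i j = 0}`, the currency of ★ `integral_matrixFourier_nilradical_eq_parabolic` — with a continuous linear chart `n : F^{I×J} ≃L 𝔫`,
`(n x) i j = x(i, j)` on the box and `0` off it. [cite: BernsteinZelevinsky1977, §2.1] -/
theorem exists_boxNilChart :
    ∃ (𝔫 : Submodule F (Matrix (Fin n) (Fin n) F)) (nc : ({i : Fin n // c i = false} × {j : Fin n // c j = true} → F) ≃L[F] ↥𝔫),
      (∀ X, X ∈ 𝔫 ↔ ∀ i j : Fin n, c j ≤ c i → X i j = 0) ∧
      ∀ x (i j : Fin n), ((nc x : ↥𝔫) : Matrix (Fin n) (Fin n) F) i j = if h : c i = false ∧ c j = true then x (⟨i, h.1⟩, ⟨j, h.2⟩) else 0 := by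
  classical
  have hle : ∀ i j : Fin n, c j ≤ c i ↔ ¬ (c i = false ∧ c j = true) := fun i j => by
    cases hi : c i <;> cases hj : c j <;> simp
  let 𝔫 : Submodule F (Matrix (Fin n) (Fin n) F) :=
    { carrier := {X | ∀ i j : Fin n, ¬ (c i = false ∧ c j = true) → X i j = 0}
      add_mem' := fun {X Y} hX hY i j hij => by simp [hX i j hij, hY i j hij]
      zero_mem' := fun i j hij => rfl
      smul_mem' := fun a X hX i j hij => by simp [hX i j hij] }
  have hmem : ∀ x : {i : Fin n // c i = false} × {j : Fin n // c j = true} → F,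
      (Matrix.of fun i j : Fin n => if h : c i = false ∧ c j = true then x (⟨i, h.1⟩, ⟨j, h.2⟩) else 0) ∈ 𝔫 := fun x i j hij => by
    simp only [Matrix.of_apply, dif_neg hij]
  refine ⟨𝔫,
    { toFun := fun x => ⟨_, hmem x⟩
      map_add' := fun x y => Subtype.ext (by
        ext i j
        simp only [Matrix.of_apply, Submodule.coe_add, Matrix.add_apply, Pi.add_apply]
        split_ifs <;> simp)
      map_smul' := fun a x => Subtype.ext (by
        ext i j
        simp only [Matrix.of_apply, Submodule.coe_smul, Matrix.smul_apply, Pi.smul_apply, smul_eq_mul, RingHom.id_apply]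
        split_ifs <;> simp)
      invFun := fun X => fun q => (X : Matrix (Fin n) (Fin n) F) q.1.1 q.2.1
      left_inv := fun x => by
        funext q
        simp only [Matrix.of_apply, dif_pos (And.intro q.1.2 q.2.2)]
      right_inv := fun X => Subtype.ext (by
        ext i j
        simp only [Matrix.of_apply]
        by_cases h : c i = false ∧ c j = true
        · rw [dif_pos h]
        · rw [dif_neg h, X.2 i j h])
      continuous_toFun := by
        refine Continuous.subtype_mk (continuous_matrix fun i j => ?_) _
        simp only [Matrix.of_apply]
        by_cases h : c i = false ∧ c j = true
        · simp only [dif_pos h]; exact continuous_apply _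
        · simp only [dif_neg h]; exact continuous_const
      continuous_invFun := continuous_pi fun q => (continuous_subtype_val.matrix_elem q.1.1 q.2.1) },
    fun X => ?_, fun x i j => rfl⟩
  change (∀ i j : Fin n, ¬ (c i = false ∧ c j = true) → X i j = 0) ↔ _
  simp only [hle]

end Box

/-! ## §2  The linear chart of the parabolic `𝔭_{(2,1)} ≤ 𝔤𝔩₃(F)` -/

omit [ValuativeRel F] [IsNonarchimedeanLocalField F] in
/-- **The chart of `𝔭_{(2,1)}`**: a subspace `𝔭 = {Y | Y.BlockTriangular ![false, false, true]} = {Y | Y₂₀ = Y₂₁ = 0}` with a continuous linear chart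
`b : F⁷ ≃L 𝔭`, `b(r) = [[r₀,r₁,r₂],[r₃,r₄,r₅],[0,0,r₆]]`. [cite: BernsteinZelevinsky1977, §2.1] -/
theorem exists_parabolicChart21 :
    ∃ (𝔭 : Submodule F (Matrix (Fin 3) (Fin 3) F)) (b : (Fin 7 → F) ≃L[F] ↥𝔭),
      (∀ Y : Matrix (Fin 3) (Fin 3) F, Y ∈ 𝔭 ↔ Y.BlockTriangular (![false, false, true] : Fin 3 → Bool)) ∧
      ∀ r : Fin 7 → F, ((b r : ↥𝔭) : Matrix (Fin 3) (Fin 3) F) = !![r 0, r 1, r 2; r 3, r 4, r 5; 0, 0, r 6] := by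
  let 𝔭 : Submodule F (Matrix (Fin 3) (Fin 3) F) :=
    { carrier := {Y | Y 2 0 = 0 ∧ Y 2 1 = 0}
      add_mem' := fun {X Y} hX hY => by simp [hX.1, hX.2, hY.1, hY.2]
      zero_mem' := ⟨rfl, rfl⟩
      smul_mem' := fun a X hX => by simp [hX.1, hX.2] }
  have hmem : ∀ r : Fin 7 → F, (!![r 0, r 1, r 2; r 3, r 4, r 5; 0, 0, r 6] : Matrix (Fin 3) (Fin 3) F) ∈ 𝔭 := fun r => ⟨rfl, rfl⟩
  have hrepr : ∀ Y : Matrix (Fin 3) (Fin 3) F, Y ∈ 𝔭 →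
      (!![Y 0 0, Y 0 1, Y 0 2; Y 1 0, Y 1 1, Y 1 2; 0, 0, Y 2 2] : Matrix (Fin 3) (Fin 3) F) = Y := fun Y hY => by
    ext i j
    fin_cases i <;> fin_cases j <;> first | rfl | exact hY.1.symm | exact hY.2.symm
  refine ⟨𝔭,
    { toFun := fun r => ⟨_, hmem r⟩
      map_add' := fun r s => Subtype.ext (by ext i j; fin_cases i <;> fin_cases j <;> simp)
      map_smul' := fun a r => Subtype.ext (by ext i j; fin_cases i <;> fin_cases j <;> simp)
      invFun := fun Y => ![(Y : Matrix (Fin 3) (Fin 3) F) 0 0, (Y : Matrix (Fin 3) (Fin 3) F) 0 1, (Y : Matrix (Fin 3) (Fin 3) F) 0 2,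
        (Y : Matrix (Fin 3) (Fin 3) F) 1 0, (Y : Matrix (Fin 3) (Fin 3) F) 1 1, (Y : Matrix (Fin 3) (Fin 3) F) 1 2, (Y : Matrix (Fin 3) (Fin 3) F) 2 2]
      left_inv := fun r => by funext i; fin_cases i <;> simp
      right_inv := fun Y => Subtype.ext (by simpa using hrepr Y.1 Y.2)
      continuous_toFun := by
        refine Continuous.subtype_mk (continuous_matrix fun i j => ?_) _
        fin_cases i <;> fin_cases j <;> simp <;> fun_prop
      continuous_invFun := by
        have hc : Continuous fun Y : ↥𝔭 => (Y : Matrix (Fin 3) (Fin 3) F) := continuous_subtype_val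
        refine continuous_pi fun i => ?_
        fin_cases i <;> simpa using hc.matrix_elem _ _ },
    fun Y => ?_, fun r => rfl⟩
  change (Y 2 0 = 0 ∧ Y 2 1 = 0) ↔ Y.BlockTriangular ![false, false, true]
  constructor
  · rintro ⟨h0, h1⟩ i j hij
    fin_cases i <;> fin_cases j <;> first | exact h0 | exact h1 | exact absurd hij (by decide)
  · intro h
    exact ⟨h (show (![false, false, true] : Fin 3 → Bool) 0 < (![false, false, true] : Fin 3 → Bool) 2 by decide),
      h (show (![false, false, true] : Fin 3 → Bool) 1 < (![false, false, true] : Fin 3 → Bool) 2 by decide)⟩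

/-! ## §3  `Λ_E ∘ 𝓕 = C · (K-average of the (2,1)-parabolic slice)` -/

section Main

variable [MeasurableSpace F] [BorelSpace F] [MeasurableSpace (GL (Fin 3) F)] [BorelSpace (GL (Fin 3) F)]
  [MeasurableSpace (Matrix (Fin 3) (Fin 3) F)] [BorelSpace (Matrix (Fin 3) (Fin 3) F)]

/-- **THE FOURIER TRANSFORM OF THE MINIMAL RICHARDSON MEASURE OF `𝔤𝔩₃(F)`.**  For Haar measures `κ` on `K = GL₃(𝒪)`, `μ_U` on the unipotent radical
`U` of `P_{(2,1)}` (`c = ![false, false, true]`), an additive Haar measure `μ𝔤` on `𝔤𝔩₃(F)`, `dx` on `F`, and a continuous non-trivial `ψ`, there is ONE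
`C > 0` such that for every `f ∈ C_c^∞(𝔤𝔩₃(F))`:
`∫_{K × U} 𝓕f(k (u − 1) k⁻¹) d(κ ⊗ μ_U) = C · ∫_K ∫_{F⁷} f(k [[r₀,r₁,r₂],[r₃,r₄,r₅],[0,0,r₆]] k⁻¹) d(dx^{⊗7}) dκ` — the minimal nilpotent orbital integral of `𝓕f` is
the `K`-average of the integral of `f` over the parabolic subalgebra `𝔭_{(2,1)} = 𝔫^⊥`.  [cite: HarishChandra1999AdmissibleDistributions, §7, Thm. 4.4] [cite: Howe1974, Prop. 3] -/
theorem exists_integral_prod_matrixFourier_minimalRichardson_eq (ψ : AddChar F Circle) (hψ : ψ.IsContinuousNontrivial)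
    (μ𝔤 : Measure (Matrix (Fin 3) (Fin 3) F)) [μ𝔤.IsAddHaarMeasure]
    (κ : Measure ↥(glInt 3 F)) [IsHaarMeasure κ] (μU : Measure ↥(unipotentRadicalGL F (![false, false, true] : Fin 3 → Bool))) [IsHaarMeasure μU]
    (dx : Measure F) [dx.IsAddHaarMeasure] :
    ∃ C : ℝ, 0 < C ∧ ∀ f : Matrix (Fin 3) (Fin 3) F → ℂ, IsLocSmooth f →
      ∫ q : ↥(glInt 3 F) × ↥(unipotentRadicalGL F (![false, false, true] : Fin 3 → Bool)),
          (fun Y : Matrix (Fin 3) (Fin 3) F => ∫ X, ((ψ (Matrix.trace (Y * X)) : Circle) : ℂ) * f X ∂μ𝔤)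
            ((((q.1 : GL (Fin 3) F)) : Matrix (Fin 3) (Fin 3) F) * ((((q.2 : GL (Fin 3) F)) : Matrix (Fin 3) (Fin 3) F) - 1) *
              ((((q.1 : GL (Fin 3) F))⁻¹ : GL (Fin 3) F) : Matrix (Fin 3) (Fin 3) F)) ∂(κ.prod μU) =
        (C : ℂ) * ∫ k : ↥(glInt 3 F), ∫ r : Fin 7 → F,
          f (((k : GL (Fin 3) F) : Matrix (Fin 3) (Fin 3) F) * !![r 0, r 1, r 2; r 3, r 4, r 5; 0, 0, r 6] *
            ((((k : GL (Fin 3) F))⁻¹ : GL (Fin 3) F) : Matrix (Fin 3) (Fin 3) F)) ∂(Measure.pi fun _ : Fin 7 => dx) ∂κ := by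
  classical
  haveI : T2Space F := (isLocalField F).toT2Space
  haveI : LocallyCompactSpace F := (isLocalField F).toLocallyCompactSpace
  haveI : SecondCountableTopology F := secondCountableTopology_localField F
  haveI : IsTopologicalRing F := inferInstance
  haveI : LocallyCompactSpace (Matrix (Fin 3) (Fin 3) F) := Pi.locallyCompactSpace_of_finite
  haveI : SecondCountableTopology (Matrix (Fin 3) (Fin 3) F) := inferInstanceAs (SecondCountableTopology (Fin 3 → Fin 3 → F))
  haveI : BorelSpace ↥(glInt 3 F) := Subtype.borelSpace _
  haveI : BorelSpace ↥(unipotentRadicalGL F (![false, false, true] : Fin 3 → Bool)) := Subtype.borelSpace _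
  haveI : CompactSpace ↥(glInt 3 F) := isCompact_iff_compactSpace.1 (isCompact_glInt 3 F)
  haveI : IsFiniteMeasure κ := CompactSpace.isFiniteMeasure
  -- charts: the ★ box chart `Ψ` of `U` with `μU = C₁ • Ψ_*(dx²)`, the linear charts of `𝔫` and `𝔭`
  obtain ⟨Ψ, hΨ, C₁, hC₁, hμU⟩ := exists_haar_eq_smul_map_box (![false, false, true] : Fin 3 → Bool) dx μU
  obtain ⟨𝔫, n, h𝔫, hn⟩ := exists_boxNilChart (F := F) (![false, false, true] : Fin 3 → Bool)
  obtain ⟨𝔭, b, h𝔭, hb⟩ := exists_parabolicChart21 (F := F)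
  haveI : BorelSpace ↥𝔫 := Subtype.borelSpace _
  haveI : BorelSpace ↥𝔭 := Subtype.borelSpace _
  -- ★ subspace Fourier for the labelling `(2,1)`, with the chart measures
  obtain ⟨c₀, hc₀, hF⟩ := integral_matrixFourier_nilradical_eq_parabolic ψ hψ μ𝔤 (![false, false, true] : Fin 3 → Bool) 𝔫 𝔭 h𝔫 h𝔭
    ((Measure.pi fun _ : {i : Fin 3 // (![false, false, true] : Fin 3 → Bool) i = false} × {j : Fin 3 // (![false, false, true] : Fin 3 → Bool) j = true} => dx).map n) ((Measure.pi fun _ : Fin 7 => dx).map b)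
  refine ⟨C₁ * c₀, mul_pos (NNReal.coe_pos.2 (pos_iff_ne_zero.2 hC₁)) hc₀, fun f hf => ?_⟩
  set Φ : Matrix (Fin 3) (Fin 3) F → ℂ := fun Y => ∫ X, ((ψ (Matrix.trace (Y * X)) : Circle) : ℂ) * f X ∂μ𝔤 with hΦ
  have hΦsm : IsLocSmooth Φ := isLocSmooth_matrixFourier hψ μ𝔤 hf
  -- `u - 1` in coordinates: `Ψ(x) - 1 = n(x)`
  have hsub : ∀ x : ({i : Fin 3 // (![false, false, true] : Fin 3 → Bool) i = false} × {j : Fin 3 // (![false, false, true] : Fin 3 → Bool) j = true} → F),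
      (((Ψ x : ↥(unipotentRadicalGL F (![false, false, true] : Fin 3 → Bool))) : GL (Fin 3) F) : Matrix (Fin 3) (Fin 3) F) - 1 = ((n x : ↥𝔫) : Matrix (Fin 3) (Fin 3) F) := fun x => by
    ext i j
    rw [Matrix.sub_apply, hΨ, hn, Matrix.one_apply, add_sub_cancel_left]
  -- Step A: `κ ⊗ μ_U = C₁ • (id × Ψ)_* (κ ⊗ dx²)`
  have hmeas : κ.prod μU = C₁ • (κ.prod (Measure.pi fun _ : {i : Fin 3 // (![false, false, true] : Fin 3 → Bool) i = false} × {j : Fin 3 // (![false, false, true] : Fin 3 → Bool) j = true} => dx)).map (Prod.map (id : ↥(glInt 3 F) → ↥(glInt 3 F)) Ψ) := by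
    have h1 : (κ.prod (Measure.pi fun _ : {i : Fin 3 // (![false, false, true] : Fin 3 → Bool) i = false} × {j : Fin 3 // (![false, false, true] : Fin 3 → Bool) j = true} => dx)).map (Prod.map (id : ↥(glInt 3 F) → ↥(glInt 3 F)) Ψ) = κ.prod ((Measure.pi fun _ : {i : Fin 3 // (![false, false, true] : Fin 3 → Bool) i = false} × {j : Fin 3 // (![false, false, true] : Fin 3 → Bool) j = true} => dx).map Ψ) := by
      rw [← Measure.map_prod_map _ _ measurable_id Ψ.continuous.measurable, Measure.map_id]
    rw [hμU, Measure.prod_smul_right, h1]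
  have hemb : MeasurableEmbedding (Prod.map (id : ↥(glInt 3 F) → ↥(glInt 3 F)) Ψ) :=
    ((MeasurableEquiv.refl ↥(glInt 3 F)).prodCongr Ψ.toMeasurableEquiv).measurableEmbedding
  rw [hmeas, integral_smul_nnreal_measure, hemb.integral_map]
  simp only [Prod.map_fst, Prod.map_snd, id_eq, hsub]
  -- Step B: Fubini on `K × F²` (the integrand is continuous with compact support)
  have hcont : Continuous fun z : ↥(glInt 3 F) × ({i : Fin 3 // (![false, false, true] : Fin 3 → Bool) i = false} × {j : Fin 3 // (![false, false, true] : Fin 3 → Bool) j = true} → F) =>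
      Φ ((((z.1 : GL (Fin 3) F)) : Matrix (Fin 3) (Fin 3) F) * ((n z.2 : ↥𝔫) : Matrix (Fin 3) (Fin 3) F) *
        ((((z.1 : GL (Fin 3) F))⁻¹ : GL (Fin 3) F) : Matrix (Fin 3) (Fin 3) F)) := by
    refine hΦsm.1.continuous.comp ?_
    have h1 : Continuous fun z : ↥(glInt 3 F) × ({i : Fin 3 // (![false, false, true] : Fin 3 → Bool) i = false} × {j : Fin 3 // (![false, false, true] : Fin 3 → Bool) j = true} → F) => (((z.1 : GL (Fin 3) F)) : Matrix (Fin 3) (Fin 3) F) :=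
      Units.continuous_val.comp (continuous_subtype_val.comp continuous_fst)
    have h2 : Continuous fun z : ↥(glInt 3 F) × ({i : Fin 3 // (![false, false, true] : Fin 3 → Bool) i = false} × {j : Fin 3 // (![false, false, true] : Fin 3 → Bool) j = true} → F) => ((((z.1 : GL (Fin 3) F))⁻¹ : GL (Fin 3) F) : Matrix (Fin 3) (Fin 3) F) :=
      Units.continuous_coe_inv.comp (continuous_subtype_val.comp continuous_fst)
    have h3 : Continuous fun z : ↥(glInt 3 F) × ({i : Fin 3 // (![false, false, true] : Fin 3 → Bool) i = false} × {j : Fin 3 // (![false, false, true] : Fin 3 → Bool) j = true} → F) => ((n z.2 : ↥𝔫) : Matrix (Fin 3) (Fin 3) F) :=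
      continuous_subtype_val.comp (n.continuous.comp continuous_snd)
    exact (h1.mul h3).mul h2
  have hcs : HasCompactSupport fun z : ↥(glInt 3 F) × ({i : Fin 3 // (![false, false, true] : Fin 3 → Bool) i = false} × {j : Fin 3 // (![false, false, true] : Fin 3 → Bool) j = true} → F) =>
      Φ ((((z.1 : GL (Fin 3) F)) : Matrix (Fin 3) (Fin 3) F) * ((n z.2 : ↥𝔫) : Matrix (Fin 3) (Fin 3) F) *
        ((((z.1 : GL (Fin 3) F))⁻¹ : GL (Fin 3) F) : Matrix (Fin 3) (Fin 3) F)) := by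
    -- `k n(p) k⁻¹ ∈ tsupport Φ ⇒ n(p) ∈ K⁻¹ (tsupport Φ) K ⇒ p ∈ π(K⁻¹ (tsupport Φ) K)`
    set C' : Set (Matrix (Fin 3) (Fin 3) F) := (fun q : ↥(glInt 3 F) × Matrix (Fin 3) (Fin 3) F =>
        ((((q.1 : GL (Fin 3) F))⁻¹ : GL (Fin 3) F) : Matrix (Fin 3) (Fin 3) F) * q.2 * (((q.1 : GL (Fin 3) F)) : Matrix (Fin 3) (Fin 3) F)) ''
      (Set.univ ×ˢ tsupport Φ) with hC'
    have hC'c : IsCompact C' := by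
      refine (isCompact_univ.prod hΦsm.2).image ?_
      exact ((Units.continuous_coe_inv.comp (continuous_subtype_val.comp continuous_fst)).mul continuous_snd).mul
        (Units.continuous_val.comp (continuous_subtype_val.comp continuous_fst))
    set π : Matrix (Fin 3) (Fin 3) F → ({i : Fin 3 // (![false, false, true] : Fin 3 → Bool) i = false} × {j : Fin 3 // (![false, false, true] : Fin 3 → Bool) j = true} → F) := fun X q => X q.1.1 q.2.1 with hπ
    have hπc : Continuous π := continuous_pi fun q => continuous_id.matrix_elem q.1.1 q.2.1
    have hπn : ∀ p : ({i : Fin 3 // (![false, false, true] : Fin 3 → Bool) i = false} × {j : Fin 3 // (![false, false, true] : Fin 3 → Bool) j = true} → F), π ((n p : ↥𝔫) : Matrix (Fin 3) (Fin 3) F) = p := fun p => by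
      funext q
      simp only [hπ, hn, dif_pos (And.intro q.1.2 q.2.2)]
    refine IsCompact.of_isClosed_subset (isCompact_univ.prod (hC'c.image hπc)) (isClosed_tsupport _)
      (closure_minimal (fun z hz => ?_) ((isCompact_univ.prod (hC'c.image hπc)).isClosed))
    refine Set.mk_mem_prod (Set.mem_univ _) ⟨((n z.2 : ↥𝔫) : Matrix (Fin 3) (Fin 3) F), ⟨⟨z.1, _⟩, Set.mk_mem_prod (Set.mem_univ _)
      (subset_tsupport _ hz), ?_⟩, hπn z.2⟩
    have hkk : ((((z.1 : GL (Fin 3) F))⁻¹ : GL (Fin 3) F) : Matrix (Fin 3) (Fin 3) F) * (((z.1 : GL (Fin 3) F)) : Matrix (Fin 3) (Fin 3) F) = 1 := by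
      rw [← Units.val_mul, inv_mul_cancel, Units.val_one]
    simp only [← Matrix.mul_assoc, hkk, Matrix.one_mul]
    rw [Matrix.mul_assoc, hkk, Matrix.mul_one]
  rw [integral_prod _ (hcont.integrable_of_hasCompactSupport hcs)]
  -- Step C: the inner integral for each `k`
  have hinner : ∀ k : ↥(glInt 3 F),
      ∫ p : ({i : Fin 3 // (![false, false, true] : Fin 3 → Bool) i = false} × {j : Fin 3 // (![false, false, true] : Fin 3 → Bool) j = true} → F), Φ ((((k : GL (Fin 3) F)) : Matrix (Fin 3) (Fin 3) F) * ((n p : ↥𝔫) : Matrix (Fin 3) (Fin 3) F) *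
          ((((k : GL (Fin 3) F))⁻¹ : GL (Fin 3) F) : Matrix (Fin 3) (Fin 3) F)) ∂(Measure.pi fun _ : {i : Fin 3 // (![false, false, true] : Fin 3 → Bool) i = false} × {j : Fin 3 // (![false, false, true] : Fin 3 → Bool) j = true} => dx) =
        (c₀ : ℂ) * ∫ r : Fin 7 → F, f (((k : GL (Fin 3) F) : Matrix (Fin 3) (Fin 3) F) * !![r 0, r 1, r 2; r 3, r 4, r 5; 0, 0, r 6] *
          ((((k : GL (Fin 3) F))⁻¹ : GL (Fin 3) F) : Matrix (Fin 3) (Fin 3) F)) ∂(Measure.pi fun _ : Fin 7 => dx) := fun k => by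
    -- `Φ(k Y k⁻¹) = 𝓕(f ∘ Ad k)(Y)`, `f ∘ Ad k ∈ C_c^∞`
    have hconj : ∀ Y : Matrix (Fin 3) (Fin 3) F, Φ ((((k : GL (Fin 3) F)) : Matrix (Fin 3) (Fin 3) F) * Y *
        ((((k : GL (Fin 3) F))⁻¹ : GL (Fin 3) F) : Matrix (Fin 3) (Fin 3) F)) =
        ∫ X, ((ψ (Matrix.trace (Y * X)) : Circle) : ℂ) *
          f ((((k : GL (Fin 3) F)) : Matrix (Fin 3) (Fin 3) F) * X * ((((k : GL (Fin 3) F))⁻¹ : GL (Fin 3) F) : Matrix (Fin 3) (Fin 3) F)) ∂μ𝔤 :=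
      fun Y => matrixFourier_conj_apply ψ μ𝔤 k.2 f Y
    have hkk : ((((k : GL (Fin 3) F))⁻¹ : GL (Fin 3) F) : Matrix (Fin 3) (Fin 3) F) * (((k : GL (Fin 3) F)) : Matrix (Fin 3) (Fin 3) F) = 1 := by
      rw [← Units.val_mul, inv_mul_cancel, Units.val_one]
    have hkk' : (((k : GL (Fin 3) F)) : Matrix (Fin 3) (Fin 3) F) * ((((k : GL (Fin 3) F))⁻¹ : GL (Fin 3) F) : Matrix (Fin 3) (Fin 3) F) = 1 := by
      rw [← Units.val_mul, mul_inv_cancel, Units.val_one]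
    let Adk : Matrix (Fin 3) (Fin 3) F ≃ₜ Matrix (Fin 3) (Fin 3) F :=
      { toFun := fun X => (((k : GL (Fin 3) F)) : Matrix (Fin 3) (Fin 3) F) * X * ((((k : GL (Fin 3) F))⁻¹ : GL (Fin 3) F) : Matrix (Fin 3) (Fin 3) F)
        invFun := fun X => ((((k : GL (Fin 3) F))⁻¹ : GL (Fin 3) F) : Matrix (Fin 3) (Fin 3) F) * X * (((k : GL (Fin 3) F)) : Matrix (Fin 3) (Fin 3) F)
        left_inv := fun X => by
          simp only [← Matrix.mul_assoc, hkk, Matrix.one_mul]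
          rw [Matrix.mul_assoc, hkk, Matrix.mul_one]
        right_inv := fun X => by
          simp only [← Matrix.mul_assoc, hkk', Matrix.one_mul]
          rw [Matrix.mul_assoc, hkk', Matrix.mul_one]
        continuous_toFun := (continuous_const.matrix_mul continuous_id).matrix_mul continuous_const
        continuous_invFun := (continuous_const.matrix_mul continuous_id).matrix_mul continuous_const }
    have hg : IsLocSmooth fun X : Matrix (Fin 3) (Fin 3) F =>
        f ((((k : GL (Fin 3) F)) : Matrix (Fin 3) (Fin 3) F) * X * ((((k : GL (Fin 3) F))⁻¹ : GL (Fin 3) F) : Matrix (Fin 3) (Fin 3) F)) :=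
      ⟨hf.1.comp_continuous Adk.continuous, hf.2.comp_homeomorph Adk⟩
    simp_rw [hconj]
    -- `∫_{F³} 𝓕g(n p) dp = ∫_{𝔫} 𝓕g dμ𝔫 = c₀ ∫_{𝔭} g dμ𝔭 = c₀ ∫_{F⁶} g(b r) dr`
    have h1 := hF _ hg.1 hg.2
    have hn_emb : MeasurableEmbedding ⇑n := n.toHomeomorph.measurableEmbedding
    have hb_emb : MeasurableEmbedding ⇑b := b.toHomeomorph.measurableEmbedding
    rw [hn_emb.integral_map, hb_emb.integral_map] at h1
    simpa only [hb] using h1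
  simp_rw [hinner]
  rw [integral_const_mul, NNReal.smul_def, Complex.real_smul]
  push_cast
  ring

end Main


end Summit.HodgeConjecture.HodgeConjecture.Cruxes.H413.K2E3GL3MinimalRichardsonFourier

end
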